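import Literature.Computability.AlgebraicComplexity.PowerSumProductMultiplicityObstruction
import Literature.Computability.AlgebraicComplexity.ProductPlusPowerObstructions
import HarnessLib

/-!
# DGIJL Prop. 4.12 by explicit tableaux, I: the frame of shape `λ = (15d-1, 10d+1, 10d, …, 10d)`

Topic `Literature/Computability/AlgebraicComplexity`; proofs file (theorems and plumbing
definitions only, no named facts). First file of an explicit-certificate proof of

* P. Dutta, F. Gesmundo, C. Ikenmeyer, G. Jindal, V. Lysikov, *Geometric complexity theory for
  product-plus-power*, J. Symbolic Comput. (2025) 102458 = arXiv:2211.07055, **Prop. 4.12**: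
  "`mult_λ(ℂ[\overline{GL_{d+1}(x_1^d + ⋯ + x_{d+1}^d)}]) ≥ 5`" for even `d` and
  `λ = (5d-1,1) + ((d+1) × (10d)) = (15d-1, 10d+1, 10d, …, 10d)`,

the only ingredient of DGIJL Thm. 4.10 not yet in the tree (`DGIJL2025_thm_4_10_of_five_le`,
`ProductPlusPowerObstructionsProofs.lean`). The printed proof invokes the tableau-lifting theorem of
Ikenmeyer–Kandasamy (STOC 2020, Thm. 4.2, §13–§21); here, as for the tree's proof of IK Thm. 4.3
(`IK2020.two_le_orbitMultiplicity_psum`, `PowerSumProductMultiplicityObstruction.lean`), five explicit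
tableau polynomials (`TabM.tabPoly`, highest-weight vectors by `tabPoly_mem_highestWeightSpace`) are
evaluated at five points `A · p` of the orbit closure (`aeval_linSubst_psum_tabPoly`,
`le_orbitMultiplicity_of_det_eval_ne_zero_of_mem_orbitClosure`). Design document of the cell
`val-lit` (rung V3): `run/shared/lean/pub/val-lit/bip/DGIJL-Prop412-DESIGN-p6.md`.

Parametrisation: `d = 2k + 4` (even `d ≥ 4`; DGIJL's "`d ≥ 3` even"), `N = d + 1 = 2k + 5`
variables, `10d + 15 = 20k + 55` labels with `d` boxes each, columns `c < 10d = 20k + 40` of full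
height `d + 1`, the column `c = 10d` of height `2`, and `5d - 2 = 10k + 18` singleton columns
(`15d - 1 = 30k + 59` columns in all); the alternator of row `i` sits on the `i`-th largest variable
`xE k i = 2k + 4 - i`.

## Contents (all generic in the tableau)

* `hgt`, `xE`, `colsAbove`, `card_filter_lt_hgt`, `dualOfPartition_dgijl_xE`: the shape, its
  column-height profile, and the identification of the tree's weight
  `Weight.dualOfPartition (d+1) (dgijlPartition d _)` with `-#{c | i < hgt c}` at `xE i`.
* `Spec`: the four box/label bookkeeping functions of a filling (`lab`, `idx`, `col`, `row`) with
  their ranges and round trips; `Spec.tab`, `Spec.frame` (the `TabM` datum and its `Frame`),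
  `Spec.tabPoly_mem` (every such filling's tableau polynomial is a highest-weight vector of weight
  `λ^*`), `Spec.aeval_tabPoly` and `Spec.term_eq` (its value at `A · p` as a sum over relabellings
  `φ` of: the product of the `10d` full-column determinants `fullDet`, the `2 × 2` minor `tallMinor`
  of the column of height `2`, and the singleton entries).
* `fullDet_eq_zero_of_not_injective`, `fullDet_pow_of_injective` (`(± det A)^d = det A ^ d`, `d`
  even — the one use of parity), `apply_eq_of_injective_of_agree_off` (the pigeonhole behind the
  "rigidity blocks" of the design).

Honest framing: infrastructure for a kernel certificate of a printed theorem on the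
product-plus-power toy model; nothing here bears on VP versus VNP.

## References

* Dutta–Gesmundo–Ikenmeyer–Jindal–Lysikov, arXiv:2211.07055, Thm. 4.10, Prop. 4.12.
  [DuttaGesmundoIkenmeyerJindalLysikovJSC2025]
* C. Ikenmeyer, U. Kandasamy, arXiv:1911.03990, Thm. 4.2 (tableau lifting), Thm. 11.1 (evaluation
  of tableau polynomials at power sums). [IkenmeyerKandasamy2019]

## Mathlib and tree

Tree: `TableauEval.TabM`, `TabM.Frame`, `TabM.tabPoly_mem_highestWeightSpace`, `IsAntitoneEnum`
(`TableauPolynomial`, `TableauScaling`, `TableauHighestWeight`), `IK2020.aeval_linSubst_psum_tabPoly`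
(`PowerSumProductMultiplicityObstruction`), `dgijlPartition` (`ProductPlusPowerObstructions`),
`Weight.dualOfPartition` (`GLHighestWeight`). Mathlib: `Matrix.det_permute'`, `Matrix.det_fin_two`,
`Matrix.det_zero_of_column_eq`, `Fin.card_filter_val_lt`, `Finite.injective_iff_surjective`.
-/

noncomputable section

open scoped BigOperators

namespace Literature.Computability.AlgebraicComplexity

namespace DGIJLLift

open TableauEval MvPolynomial
open _root_.Literature.NumberTheory.DiophantineGeometry

variable (k : ℕ)

/-! ### §1 The shape: column heights, the antitone enumeration, the weight -/

/-- Column heights of `λ = (15d-1, 10d+1, 10d, …, 10d)`, `d = 2k+4`: `10d` full columns, one column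
of height `2`, then singletons. [cite: DuttaGesmundoIkenmeyerJindalLysikovJSC2025, Thm. 4.10] -/
def hgt (k c : ℕ) : ℕ :=
  if c < 20 * k + 40 then 2 * k + 5 else if c = 20 * k + 40 then 2 else 1

/-- Every column has height `≤ d + 1`. [cite: DuttaGesmundoIkenmeyerJindalLysikovJSC2025, Prop. 4.12] -/
theorem hgt_le (c : ℕ) : hgt k c ≤ 2 * k + 5 := by
  unfold hgt; split_ifs <;> omega

/-- Every column has height `≥ 1`. [cite: DuttaGesmundoIkenmeyerJindalLysikovJSC2025, Prop. 4.12] -/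
theorem one_le_hgt (c : ℕ) : 1 ≤ hgt k c := by
  unfold hgt; split_ifs <;> omega

/-- The antitone enumeration `xE i = d - i` of the variables `Fin (d+1)` (largest first).
[folklore] -/
def xE (k i : ℕ) : Fin (2 * k + 5) := ⟨2 * k + 4 - i, by omega⟩

/-- Value of the enumeration. [cite: DuttaGesmundoIkenmeyerJindalLysikovJSC2025, Prop. 4.12] -/
@[simp] theorem xE_val (i : ℕ) : (xE k i : ℕ) = 2 * k + 4 - i := rfl

/-- `xE` is an antitone enumeration of `Fin (d+1)`. [cite: DuttaGesmundoIkenmeyerJindalLysikovJSC2025, Prop. 4.12] -/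
theorem isAntitoneEnum_xE : IsAntitoneEnum (xE k) (2 * k + 5) where
  anti i j hij hj := by
    rw [Fin.lt_def, xE_val, xE_val]
    omega
  surj v := ⟨2 * k + 4 - v, by omega, Fin.ext (by rw [xE_val]; omega)⟩

/-- On `Fin (d+1)` the enumeration is `Fin.rev`. [cite: DuttaGesmundoIkenmeyerJindalLysikovJSC2025, Prop. 4.12] -/
theorem xE_fin (i : Fin (2 * k + 5)) : xE k i = Fin.rev i := by
  apply Fin.ext
  rw [xE_val, Fin.val_rev]
  omega

/-- `λ_i` = the number of columns of height `> i`: `15d-1`, `10d+1`, `10d` for `i = 0, 1, ≥ 2`.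
[cite: DuttaGesmundoIkenmeyerJindalLysikovJSC2025, Thm. 4.10] -/
def colsAbove (k i : ℕ) : ℕ :=
  if i = 0 then 30 * k + 59 else if i = 1 then 20 * k + 41 else 20 * k + 40

/-- The number of columns of height `> i` is `colsAbove k i`. [cite: DuttaGesmundoIkenmeyerJindalLysikovJSC2025, Prop. 4.12] -/
theorem card_filter_lt_hgt (i : ℕ) (hi : i < 2 * k + 5) :
    (Finset.univ.filter fun c : Fin (30 * k + 59) => i < hgt k c).card = colsAbove k i := by
  unfold colsAbove
  by_cases h0 : i = 0
  · subst h0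
    rw [if_pos rfl, Finset.filter_true_of_mem, Finset.card_univ, Fintype.card_fin]
    intro c _
    exact one_le_hgt k c
  · rw [if_neg h0]
    by_cases h1 : i = 1
    · subst h1
      rw [if_pos rfl]
      have hset : (Finset.univ.filter fun c : Fin (30 * k + 59) => 1 < hgt k c) =
          Finset.univ.filter fun c : Fin (30 * k + 59) => (c : ℕ) < 20 * k + 41 := by
        apply Finset.filter_congr
        intro c _
        unfold hgt
        split_ifs <;> omega
      rw [hset, Fin.card_filter_val_lt]
      omega
    · rw [if_neg h1]
      have hset : (Finset.univ.filter fun c : Fin (30 * k + 59) => i < hgt k c) =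
          Finset.univ.filter fun c : Fin (30 * k + 59) => (c : ℕ) < 20 * k + 40 := by
        apply Finset.filter_congr
        intro c _
        unfold hgt
        split_ifs <;> omega
      rw [hset, Fin.card_filter_val_lt]
      omega

/-- The sorted parts of `λ = (15d-1, 10d+1, 10d, …, 10d)` (`d + 1` parts); re-derived from the
(private) lemma of `ProductPlusPowerObstructionsProofs.lean`.
[cite: DuttaGesmundoIkenmeyerJindalLysikovJSC2025, Thm. 4.10] -/
theorem sortedParts_dgijlPartition {d : ℕ} (hd : 0 < d) :
    (dgijlPartition d hd).sortedParts =
      (15 * d - 1) :: (10 * d + 1) :: List.replicate (d - 1) (10 * d) := by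
  change (dgijlPartition d hd).parts.sort (· ≥ ·) = _
  have hparts : (dgijlPartition d hd).parts =
      ↑((15 * d - 1) :: (10 * d + 1) :: List.replicate (d - 1) (10 * d)) := by
    rw [dgijlPartition, Nat.Partition.ofSums_parts, Multiset.filter_eq_self.mpr, Multiset.insert_eq_cons,
      Multiset.cons_add, Multiset.singleton_add, ← Multiset.coe_replicate, Multiset.cons_coe,
      Multiset.cons_coe]
    intro a ha
    simp only [Multiset.insert_eq_cons, Multiset.mem_add, Multiset.mem_cons, Multiset.mem_singleton,
      Multiset.mem_replicate] at ha
    omega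
  rw [hparts, Multiset.coe_sort]
  apply List.mergeSort_eq_self
  rw [List.pairwise_cons, List.pairwise_cons]
  refine ⟨fun b hb => ?_, fun b hb => ?_, List.pairwise_replicate.mpr (Or.inr le_rfl)⟩
  · rw [List.mem_cons, List.mem_replicate] at hb
    omega
  · rw [List.mem_replicate] at hb
    omega

/-- **The weight bookkeeping**: the tree's weight `λ^* = Weight.dualOfPartition (d+1) λ` of the
named fact `DGIJL2025_thm_4_10` takes the value `-λ_i = -colsAbove k i` at the `i`-th largest
variable `xE k i`. [cite: IkenmeyerKandasamy2019, Thm. 11.1] -/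
theorem dualOfPartition_dgijl_xE (i : ℕ) (hi : i < 2 * k + 5) :
    Weight.dualOfPartition (2 * k + 5) (dgijlPartition (2 * k + 4) (by omega)) (xE k i) =
      -((colsAbove k i : ℕ) : ℤ) := by
  unfold Weight.dualOfPartition Weight.dual Weight.ofPartition
  rw [sortedParts_dgijlPartition (by omega : 0 < 2 * k + 4)]
  have hrev : ((Fin.rev (xE k i) : Fin (2 * k + 5)) : ℕ) = i := by
    rw [Fin.val_rev, xE_val]; omega
  rw [hrev, neg_inj, Nat.cast_inj]
  unfold colsAbove
  rcases Nat.eq_zero_or_pos i with rfl | hpos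
  · rw [List.getD_cons_zero, if_pos rfl]; omega
  · obtain ⟨j, rfl⟩ : ∃ j, i = j + 1 := ⟨i - 1, by omega⟩
    rw [List.getD_cons_succ, if_neg (by omega)]
    rcases Nat.eq_zero_or_pos j with rfl | hj
    · rw [List.getD_cons_zero, if_pos rfl]; omega
    · obtain ⟨j', rfl⟩ : ∃ j', j = j' + 1 := ⟨j - 1, by omega⟩
      rw [List.getD_cons_succ, List.getD_eq_getElem _ _ (by rw [List.length_replicate]; omega),
        List.getElem_replicate, if_neg (by omega)]
      omega

/-! ### §2 Fillings of the shape: the four bookkeeping functions, the datum, its frame -/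

/-- **A filling of `λ` with `10d + 15` labels, `d` boxes each**, given by its four bookkeeping
functions on naturals (junk outside the ranges): `lab c r` / `idx c r` = the label of the box in
column `c`, row `r` and its index among that label's boxes; `col u s` / `row u s` = the box of the
`s`-th occurrence of label `u`; with their ranges and the two round trips (so that boxes and
(label, index) pairs are in bijection). The data of a tableau "`T : λ → {1, …, δ}` in which every
entry appears exactly `D` many times" (IK Thm. 4.2 / §13). [cite: IkenmeyerKandasamy2019, §13 (Thm. 4.2)] -/
structure Spec (k : ℕ) where
  /-- label of the box `(c, r)` -/
  lab : ℕ → ℕ → ℕ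
  /-- index of the box `(c, r)` among the boxes of its label -/
  idx : ℕ → ℕ → ℕ
  /-- column of the `s`-th box of label `u` -/
  col : ℕ → ℕ → ℕ
  /-- row of the `s`-th box of label `u` -/
  row : ℕ → ℕ → ℕ
  /-- range of `col` -/
  col_lt : ∀ {u s : ℕ}, u < 20 * k + 55 → s < 2 * k + 4 → col u s < 30 * k + 59
  /-- range of `row` -/
  row_lt : ∀ {u s : ℕ}, u < 20 * k + 55 → s < 2 * k + 4 → row u s < hgt k (col u s)
  /-- range of `lab` -/
  lab_lt : ∀ {c r : ℕ}, c < 30 * k + 59 → r < hgt k c → lab c r < 20 * k + 55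
  /-- range of `idx` -/
  idx_lt : ∀ {c r : ℕ}, c < 30 * k + 59 → r < hgt k c → idx c r < 2 * k + 4
  /-- round trip at labels -/
  lab_col_row : ∀ {u s : ℕ}, u < 20 * k + 55 → s < 2 * k + 4 → lab (col u s) (row u s) = u
  /-- round trip at indices -/
  idx_col_row : ∀ {u s : ℕ}, u < 20 * k + 55 → s < 2 * k + 4 → idx (col u s) (row u s) = s
  /-- round trip at columns -/
  col_lab_idx : ∀ {c r : ℕ}, c < 30 * k + 59 → r < hgt k c → col (lab c r) (idx c r) = c
  /-- round trip at rows -/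
  row_lab_idx : ∀ {c r : ℕ}, c < 30 * k + 59 → r < hgt k c → row (lab c r) (idx c r) = r

namespace Spec

variable {k} (S : Spec k)

/-- The tableau datum of a filling: `15d - 1` columns of heights `hgt`, `10d + 15` labels with
`d` boxes each, alternators on the largest variables. [folklore] -/
def tab : TabM (Fin (2 * k + 5)) where
  C := 30 * k + 59
  d := 20 * k + 55
  m := 2 * k + 4
  h c := hgt k c
  var _ i := xE k i
  box u s := ⟨⟨S.col u s, S.col_lt u.2 s.2⟩, ⟨S.row u s, S.row_lt u.2 s.2⟩⟩

/-- Number of columns. [cite: IkenmeyerKandasamy2019, Thm. 11.1] -/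
@[simp] theorem tab_C : S.tab.C = 30 * k + 59 := rfl
/-- Number of labels. [cite: IkenmeyerKandasamy2019, Thm. 11.1] -/
@[simp] theorem tab_d : S.tab.d = 20 * k + 55 := rfl
/-- Boxes per label. [cite: IkenmeyerKandasamy2019, Thm. 11.1] -/
@[simp] theorem tab_m : S.tab.m = 2 * k + 4 := rfl
/-- Column heights. [cite: IkenmeyerKandasamy2019, Thm. 11.1] -/
theorem tab_h (c : Fin S.tab.C) : S.tab.h c = hgt k c := rfl

/-- Two boxes with the same column and row numbers are equal. [folklore] -/
private theorem box_ext {n : ℕ} {η : Fin n → ℕ} {b b' : (c : Fin n) × Fin (η c)}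
    (h1 : (b.1 : ℕ) = b'.1) (h2 : (b.2 : ℕ) = b'.2) : b = b' := by
  obtain ⟨c, r⟩ := b
  obtain ⟨c', r'⟩ := b'
  obtain rfl : c = c' := Fin.ext h1
  obtain rfl : r = r' := Fin.ext h2
  rfl

/-- The frame (boxes ↔ (label, index) as a bijection) of a filling. [folklore] -/
def frame : S.tab.Frame where
  boxEquiv :=
    { toFun := fun p => S.tab.box p.1 p.2
      invFun := fun b => (⟨S.lab b.1 b.2, S.lab_lt b.1.2 b.2.2⟩, ⟨S.idx b.1 b.2, S.idx_lt b.1.2 b.2.2⟩)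
      left_inv := fun p => by
        obtain ⟨u, s⟩ := p
        exact Prod.ext (Fin.ext (S.lab_col_row u.2 s.2)) (Fin.ext (S.idx_col_row u.2 s.2))
      right_inv := fun b => box_ext (S.col_lab_idx b.1.2 b.2.2) (S.row_lab_idx b.1.2 b.2.2) }
  box_eq _ _ := rfl

/-- The label of the box `(c, r)` read through the frame is `lab c r`. [cite: IkenmeyerKandasamy2019, Thm. 11.1] -/
theorem frame_symm_fst (c : Fin S.tab.C) (r : Fin (S.tab.h c)) :
    ((S.frame.boxEquiv.symm ⟨c, r⟩).1 : ℕ) = S.lab c r := rfl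

/-- **Every filling's tableau polynomial is a highest-weight vector of weight `λ^*`** (the weight of
the named fact `DGIJL2025_thm_4_10`), by the tree's `tabPoly_mem_highestWeightSpace` and the weight
bookkeeping `dualOfPartition_dgijl_xE`. [cite: IkenmeyerKandasamy2019, Thm. 11.1] -/
theorem tabPoly_mem :
    S.tab.tabPoly ℂ ∈ highestWeightSpace (coordRep (Fin (2 * k + 5)) ℂ (2 * k + 4))
      (Weight.dualOfPartition (2 * k + 5) (dgijlPartition (2 * k + 4) (by omega))) := by
  refine S.tab.tabPoly_mem_highestWeightSpace S.frame (isAntitoneEnum_xE k)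
    (fun c => hgt_le k _) (fun c r => rfl) _ (fun i hi => ?_)
  show _ = -((Finset.univ.filter fun c : Fin (30 * k + 59) => i < hgt k c).card : ℤ)
  rw [dualOfPartition_dgijl_xE k i hi, card_filter_lt_hgt k i hi]

end Spec

/-! ### §3 The value at `A · p` as a sum over relabellings -/

/-- A relabelling extended to all naturals (junk `0` beyond the labels). [folklore] -/
def extF (φ : Fin (20 * k + 55) → Fin (2 * k + 5)) (u : ℕ) : Fin (2 * k + 5) :=
  if h : u < 20 * k + 55 then φ ⟨u, h⟩ else ⟨0, by omega⟩

/-- `extF` agrees with `φ` on labels. [cite: IkenmeyerKandasamy2019, Thm. 11.1] -/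
theorem extF_of_lt (φ : Fin (20 * k + 55) → Fin (2 * k + 5)) {u : ℕ} (hu : u < 20 * k + 55) :
    extF k φ u = φ ⟨u, hu⟩ := by
  unfold extF; rw [dif_pos hu]

/-- The column determinant of height `n` with label function `g` at `A` under `φ`. [folklore] -/
def colVal (A : Matrix (Fin (2 * k + 5)) (Fin (2 * k + 5)) ℂ) (φ : Fin (20 * k + 55) → Fin (2 * k + 5))
    (n : ℕ) (g : ℕ → ℕ) : ℂ :=
  (Matrix.of fun i r : Fin n => A (xE k i) (extF k φ (g r))).det

/-- The determinant of a full column whose rows receive the values `w`. [folklore] -/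
def fullDet (A : Matrix (Fin (2 * k + 5)) (Fin (2 * k + 5)) ℂ)
    (w : Fin (2 * k + 5) → Fin (2 * k + 5)) : ℂ :=
  (Matrix.of fun i r : Fin (2 * k + 5) => A (xE k i) (w r)).det

/-- The `2 × 2` minor of the column of height `2`: rows `xE 0`, `xE 1`, columns `x` (row `0` of the
tableau) and `y` (row `1`). [folklore] -/
def tallMinor (A : Matrix (Fin (2 * k + 5)) (Fin (2 * k + 5)) ℂ) (x y : Fin (2 * k + 5)) : ℂ :=
  A (xE k 0) x * A (xE k 1) y - A (xE k 0) y * A (xE k 1) x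

variable {k}

/-- **Value of a filling's tableau polynomial at `A · p = ∑_j (A e_j)^d`**, as a sum over
relabellings `φ` of products of column determinants (IK Thm. 11.1; tree
`IK2020.aeval_linSubst_psum_tabPoly`). [cite: IkenmeyerKandasamy2019, Thm. 11.1] -/
theorem Spec.aeval_tabPoly (S : Spec k) (A : Matrix (Fin (2 * k + 5)) (Fin (2 * k + 5)) ℂ) :
    aeval (formCoeff (2 * k + 4)
        (linSubst (Fin (2 * k + 5)) ℂ A (psum (Fin (2 * k + 5)) ℂ (2 * k + 4)))) (S.tab.tabPoly ℂ) =
      ((2 * k + 4).factorial : ℂ) ^ (20 * k + 55) * ∑ φ : Fin (20 * k + 55) → Fin (2 * k + 5),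
        ∏ c : Fin (30 * k + 59), colVal k A φ (hgt k c) (S.lab c) := by
  refine (IK2020.aeval_linSubst_psum_tabPoly S.tab S.frame A).trans ?_
  have hcol : ∀ (φ : Fin (20 * k + 55) → Fin (2 * k + 5)) (c : Fin S.tab.C),
      (Matrix.of fun i r : Fin (S.tab.h c) =>
          A (S.tab.var c i) (φ (S.frame.boxEquiv.symm ⟨c, r⟩).1)).det =
        colVal k A φ (hgt k c) (S.lab c) := by
    intro φ c
    unfold colVal
    congr 1
    ext i r
    simp only [Matrix.of_apply]
    rw [extF_of_lt k φ (S.lab_lt c.2 r.2)]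
    rfl
  simp only [hcol]
  rfl

variable (k) in
/-- Splitting the product over the `15d - 1` columns into the full columns, the column of height
`2`, and the singletons. [cite: IkenmeyerKandasamy2019, Thm. 11.1] -/
theorem prod_cols_split (W : ℕ → ℂ) :
    ∏ c : Fin (30 * k + 59), W c =
      (∏ c ∈ Finset.range (20 * k + 40), W c) * W (20 * k + 40) *
        ∏ t ∈ Finset.range (10 * k + 18), W (20 * k + 41 + t) := by
  rw [Fin.prod_univ_eq_prod_range W (30 * k + 59),
    show 30 * k + 59 = (20 * k + 41) + (10 * k + 18) by ring, Finset.prod_range_add,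
    Finset.prod_range_succ]

/-- A full column contributes `fullDet`. [cite: IkenmeyerKandasamy2019, Thm. 11.1] -/
theorem colVal_full (A : Matrix (Fin (2 * k + 5)) (Fin (2 * k + 5)) ℂ)
    (φ : Fin (20 * k + 55) → Fin (2 * k + 5)) {c : ℕ} (hc : c < 20 * k + 40) (g : ℕ → ℕ) :
    colVal k A φ (hgt k c) g = fullDet k A fun r => extF k φ (g r) := by
  have h : hgt k c = 2 * k + 5 := by unfold hgt; rw [if_pos hc]
  unfold colVal fullDet
  rw [h]

/-- The column of height `2` contributes the `2 × 2` minor. [cite: IkenmeyerKandasamy2019, Thm. 11.1] -/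
theorem colVal_tall (A : Matrix (Fin (2 * k + 5)) (Fin (2 * k + 5)) ℂ)
    (φ : Fin (20 * k + 55) → Fin (2 * k + 5)) (g : ℕ → ℕ) :
    colVal k A φ (hgt k (20 * k + 40)) g = tallMinor k A (extF k φ (g 0)) (extF k φ (g 1)) := by
  have h : hgt k (20 * k + 40) = 2 := by unfold hgt; rw [if_neg (lt_irrefl _), if_pos rfl]
  unfold colVal tallMinor
  rw [h, Matrix.det_fin_two]
  simp only [Matrix.of_apply, Fin.val_zero, Fin.val_one]

/-- A singleton column contributes the entry `A (xE 0) (φ label)`. [cite: IkenmeyerKandasamy2019, Thm. 11.1] -/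
theorem colVal_single (A : Matrix (Fin (2 * k + 5)) (Fin (2 * k + 5)) ℂ)
    (φ : Fin (20 * k + 55) → Fin (2 * k + 5)) {c : ℕ} (hc : 20 * k + 40 < c) (g : ℕ → ℕ) :
    colVal k A φ (hgt k c) g = A (xE k 0) (extF k φ (g 0)) := by
  have h : hgt k c = 1 := by unfold hgt; rw [if_neg (by omega), if_neg (by omega)]
  unfold colVal
  rw [h, Matrix.det_fin_one, Matrix.of_apply]
  rfl

/-- **The term of `φ`**: the product over all columns is (product of the `10d` full-column
determinants) × (the `2 × 2` minor) × (the `5d - 2` singleton entries).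
[cite: IkenmeyerKandasamy2019, Thm. 11.1] -/
theorem Spec.term_eq (S : Spec k) (A : Matrix (Fin (2 * k + 5)) (Fin (2 * k + 5)) ℂ)
    (φ : Fin (20 * k + 55) → Fin (2 * k + 5)) :
    ∏ c : Fin (30 * k + 59), colVal k A φ (hgt k c) (S.lab c) =
      (∏ c ∈ Finset.range (20 * k + 40), fullDet k A fun r => extF k φ (S.lab c r)) *
        tallMinor k A (extF k φ (S.lab (20 * k + 40) 0)) (extF k φ (S.lab (20 * k + 40) 1)) *
        ∏ t ∈ Finset.range (10 * k + 18), A (xE k 0) (extF k φ (S.lab (20 * k + 41 + t) 0)) := by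
  rw [prod_cols_split k (fun c => colVal k A φ (hgt k c) (S.lab c))]
  congr 1
  · congr 1
    · refine Finset.prod_congr rfl fun c hc => ?_
      rw [Finset.mem_range] at hc
      exact colVal_full A φ hc _
    · exact colVal_tall A φ _
  · refine Finset.prod_congr rfl fun t ht => ?_
    exact colVal_single A φ (by omega) _

/-! ### §4 Full-column determinants: repeated values, bijective values, parity -/

/-- A repeated value kills a full-column determinant (two equal columns). [cite: IkenmeyerKandasamy2019, Thm. 11.1] -/
theorem fullDet_eq_zero_of_not_injective {A : Matrix (Fin (2 * k + 5)) (Fin (2 * k + 5)) ℂ}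
    {w : Fin (2 * k + 5) → Fin (2 * k + 5)} (hw : ¬ Function.Injective w) : fullDet k A w = 0 := by
  obtain ⟨r, r', heq, hne⟩ := Function.not_injective_iff.mp hw
  exact Matrix.det_zero_of_column_eq hne fun i => by simp only [Matrix.of_apply, heq]

/-- For bijective values the full-column determinant is `± det A`. [cite: IkenmeyerKandasamy2019, Thm. 11.1] -/
theorem fullDet_sq_of_injective {A : Matrix (Fin (2 * k + 5)) (Fin (2 * k + 5)) ℂ}
    {w : Fin (2 * k + 5) → Fin (2 * k + 5)} (hw : Function.Injective w) :
    fullDet k A w ^ 2 = A.det ^ 2 := by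
  have hbij : Function.Bijective w := Finite.injective_iff_bijective.mp hw
  set e : Equiv.Perm (Fin (2 * k + 5)) := Equiv.ofBijective w hbij with he
  have hM : (Matrix.of fun i r : Fin (2 * k + 5) => A (xE k i) (w r)) =
      (A.submatrix id e).submatrix Fin.revPerm id := by
    ext i r
    simp only [Matrix.submatrix_apply, Matrix.of_apply, id, xE_fin, Fin.revPerm_apply, he,
      Equiv.ofBijective_apply]
  unfold fullDet
  rw [hM, Matrix.det_permute, Matrix.det_permute']
  rcases Int.units_eq_one_or (Equiv.Perm.sign (Fin.revPerm : Equiv.Perm (Fin (2 * k + 5))))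
    with h1 | h1 <;>
  rcases Int.units_eq_one_or (Equiv.Perm.sign e) with h2 | h2 <;>
  · rw [h1, h2]; push_cast; ring

/-- **Parity**: for bijective values, `fullDet ^ d = det A ^ d` (`d = 2k + 4` even) — a block of
`d` columns with identical values contributes `det A ^ d` whatever the sign of its columns. The
only use of "`d` even" in the certificate. [cite: DuttaGesmundoIkenmeyerJindalLysikovJSC2025, Prop. 4.12] -/
theorem fullDet_pow_of_injective {A : Matrix (Fin (2 * k + 5)) (Fin (2 * k + 5)) ℂ}
    {w : Fin (2 * k + 5) → Fin (2 * k + 5)} (hw : Function.Injective w) :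
    fullDet k A w ^ (2 * k + 4) = A.det ^ (2 * k + 4) := by
  rw [show 2 * k + 4 = 2 * (k + 2) by ring, pow_mul, fullDet_sq_of_injective hw, ← pow_mul]

/-- A product of full-column determinants is nonzero only if every column receives distinct
values. [cite: IkenmeyerKandasamy2019, Thm. 11.1] -/
theorem injective_of_prod_fullDet_ne_zero {A : Matrix (Fin (2 * k + 5)) (Fin (2 * k + 5)) ℂ}
    {ι : Type*} {s : Finset ι} {w : ι → Fin (2 * k + 5) → Fin (2 * k + 5)}
    (h : ∏ c ∈ s, fullDet k A (w c) ≠ 0) {c : ι} (hc : c ∈ s) : Function.Injective (w c) := by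
  by_contra hw
  exact h (Finset.prod_eq_zero hc (fullDet_eq_zero_of_not_injective hw))

/-! ### §5 The pigeonhole of the rigidity blocks -/

/-- **Rigidity**: two injective value vectors on `Fin (n+1)` that agree off one row agree at that
row too (the value there is the unique one missed by the others). [cite: DuttaGesmundoIkenmeyerJindalLysikovJSC2025, Prop. 4.12] -/
theorem apply_eq_of_injective_of_agree_off {n : ℕ} {w w' : Fin (n + 1) → Fin (n + 1)}
    (r₀ : Fin (n + 1)) (hw : Function.Injective w) (hw' : Function.Injective w')
    (h : ∀ i, i ≠ r₀ → w i = w' i) : w r₀ = w' r₀ := by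
  by_contra hne
  have hsurj : Function.Surjective w' := Finite.injective_iff_surjective.mp hw'
  obtain ⟨i, hi⟩ := hsurj (w r₀)
  have hi0 : i ≠ r₀ := by
    rintro rfl; exact hne hi.symm
  have : w i = w r₀ := by rw [h i hi0, hi]
  exact hi0 (hw this)

/-- Rigidity along a block: if the columns `w j` (`j ∈ s`) of a block are injective and agree with
`w j₀` off the row `r₀`, they agree with `w j₀` everywhere. [cite: DuttaGesmundoIkenmeyerJindalLysikovJSC2025, Prop. 4.12] -/
theorem eq_of_injective_of_agree_off {n : ℕ} {w w' : Fin (n + 1) → Fin (n + 1)}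
    (r₀ : Fin (n + 1)) (hw : Function.Injective w) (hw' : Function.Injective w')
    (h : ∀ i, i ≠ r₀ → w i = w' i) : w = w' := by
  funext i
  by_cases hi : i = r₀
  · subst hi; exact apply_eq_of_injective_of_agree_off i hw hw' h
  · exact h i hi

end DGIJLLift

end Literature.Computability.AlgebraicComplexity

end
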